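import Mathlib
import HarnessLib
import HarnessLib.Audit
import Summits.QuantumFields.YangMills.Theses.CoincidenceRotationBootstrap
import Summits.QuantumFields.YangMills.Theorems.HypercubicLimit.Negative.ExtendByZero
import Summits.QuantumFields.YangMills.Theorems.MirrorModularBoostsHypercubicLimitFluctuationResponse
import Summits.QuantumFields.YangMills.Theorems.MirrorModularBoostsHypercubicLimitCauchyTransfer
import Summits.QuantumFields.YangMills.Theorems.MirrorModularBoostsHypercubicLimitCovBookkeeping
import Summits.QuantumFields.YangMills.Theorems.MirrorModularBoostsHypercubicLimitTypedResponseVacuous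
import Summits.QuantumFields.YangMills.Theorems.MirrorModularBoostsHypercubicLimitTypedResponseNoGo
import Summits.QuantumFields.YangMills.Theorems.CoincidenceRotationBootstrapHypercubicLimitOneFieldWeak
import Summits.QuantumFields.YangMills.Theorems.MirrorModularBoostsHypercubicLimitCauchyTransferAll
import Summits.QuantumFields.YangMills.Theorems.MirrorModularBoostsHypercubicLimitCouplingResponseDefs
import Summits.QuantumFields.YangMills.Theorems.MirrorModularBoostsHypercubicLimitResponseSmooth
import Summits.QuantumFields.YangMills.Theorems.MirrorModularBoostsHypercubicLimitSignPolarisation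
import Summits.QuantumFields.YangMills.Theorems.MirrorModularBoostsHypercubicLimitDerivToMoments
import Summits.QuantumFields.YangMills.Theorems.MirrorModularBoostsHypercubicLimitCouplingResponseDefsC
import Summits.QuantumFields.YangMills.Theorems.MirrorModularBoostsHypercubicLimitPlanesTransfer
import Summits.QuantumFields.YangMills.Theorems.MirrorModularBoostsHypercubicLimitSubschemeDefs
import Summits.QuantumFields.YangMills.Theorems.MirrorModularBoostsHypercubicLimitIRInputsDefs
import Summits.QuantumFields.YangMills.Theorems.MirrorModularBoostsHypercubicLimitPlaneLimitsDefs
import Summits.QuantumFields.YangMills.Theorems.MirrorModularBoostsHypercubicLimitClosureHalvesDefs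
import Summits.QuantumFields.YangMills.Theorems.MirrorModularBoostsHypercubicLimitPlaneLimitsOfBound
import Summits.QuantumFields.YangMills.Theorems.MirrorModularBoostsHypercubicLimitSoftLegsAssembly
import Summits.QuantumFields.YangMills.Theorems.MirrorModularBoostsHypercubicLimitSoftLegsAssemblyMono
import Summits.QuantumFields.YangMills.Theorems.MirrorModularBoostsHypercubicLimitTranslationPlanes
import Summits.QuantumFields.YangMills.Theorems.MirrorModularBoostsHypercubicLimitFunctionalBoundPlanes
import Summits.QuantumFields.YangMills.Theorems.LangevinControlUVOSLegsFromFemtoAndGapStubAssemblyHermitian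
import Summits.QuantumFields.YangMills.Theorems.PencilRigidityWeakCouplingHypercubicLimitIRInputsOfColdPressure
import Summits.QuantumFields.YangMills.Theorems.PencilRigidityWeakCouplingHypercubicLimitRPPosOfPlaneLimits
import Summits.QuantumFields.YangMills.Theorems.PencilRigidityWeakCouplingHypercubicLimitDecayOfRPSpectral
import Summits.QuantumFields.YangMills.Theorems.PencilRigidityWeakCouplingHypercubicLimitSignedPerm
import Literature.MathematicalPhysics.QuantumFieldTheory.YangMillsOS
import Literature.MathematicalPhysics.QuantumLattice.WilsonFeynmanHellmann

/-!
# Skeleton — line `Sketch` (card `holomorphic-coupling-response`) for the crux `HypercubicLimit`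
# (stmt-QuantumFields-16154; decl `Summit.QuantumFields.YangMills.Theses.CoincidenceRotationBootstrap.HypercubicLimit`,
# verbatim `= MirrorModularBoosts.WeakCouplingHypercubicLimit`)

Registered skeleton of the line.  Lead prover-line-stmt-QuantumFields-16154-0 (cycles 1–2, reshape 1), continued by the
c2 seat prover-line-stmt-QuantumFields-16154-c2-0 (reshape 2, 2026-08-16T22Z): the line's objects are now IMPORTED from the
landed `Theorems/MirrorModularBoostsHypercubicLimitCouplingResponseDefs.lean` (p122858 + p123986: `curvField`, `wilsonAt`,
`response`, `ResponseHolomorphyOne`, `ResponseDerivBounds`, `UniformMomentBounds`, `OneFieldClauses`,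
`responseDerivBounds_of_responseHolomorphyOne`), and the provable stub `stub_derivToMoments` is stated in TREE vocabulary
(`ResponseDerivBounds r sch → UniformMomentBounds r sch`) so that its landing is a pure proof.  `IRInputs`,
`LineInputsOne`, `Closure` are unchanged (lead -0's reshape 1).

## The line in one paragraph
The curvature species `P = actionDensity r.ρ` is the density conjugate to Wilson's inverse coupling, so
tilting the step-`k` Wilson measure by `t · Φ_k(f₁)` (`Φ_k` = the statement's smeared renormalised
curvature field `smearedLatticeField …`) is Wilson's theory with the locally modulated coupling
`β_k + t c_k a_k⁴ f₁(a_k x)`.  The RESPONSE `t ↦ ⟨Φ_k(f₀)⟩_{k,t}` (one complex source) is the generating function of the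
truncated lattice functions of the curvature with the modulation repeated; C⁺ AT ORDER ONE (`ResponseHolomorphyOne`) =
holomorphy of the response on a `k`-uniform disc with a `k`-uniform bound, for NORMALISED disjoint real pairs; one-variable
Cauchy (LANDED `stub_cauchyTransferAll`) turns it into `k`-uniform bounds `C₀ C₁ⁿ n!` on all real derivatives at `0`
(`ResponseDerivBounds`); the moment recursion + sign polarisation (`stub_derivToMoments`, reshape 2: PROVABLE, this seat)
turns those into `k`-uniform `n!`-bounds on the lattice `n`-point functions on disjoint normalised real product tensors
(`UniformMomentBounds`) = the UV half of E0′ for the curvature species; the IR inputs (uniform lattice gap in RP-spectral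
form, non-triviality and `κ₃` floors) are imported (`stub_lineInputsOne`, OPEN with C⁺ itself), and the closure
(`stub_closure`: subsequence, OS inheritance, gap transfer; L/XL formalisation) returns the one-field clauses, which give the
crux by the one-field reduction at weak coupling (LANDED `hypercubicLimit_iff_oneFieldWeak`, p123041).

## Reshape 2 (c2 seat): why `stub_derivToMoments` needs no cumulant library
Define, for a bounded observable `X` and a finset-indexed family `(Yᵢ)`, the mixed coefficients `A_X(s)` by the MOMENT
RECURSION `E[X ∏_{i∈s} Yᵢ] = Σ_{t ⊆ s} A_X(t) · E[∏_{i∈s∖t} Yᵢ]` (well-founded on `⊊`).  Then: (i) `A_X` is multilinear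
and relabelling-invariant (strong induction); (ii) on a constant family `Yᵢ ≡ W`, `A_X(s) = d^{|s|}/dt^{|s|}|₀ ∫ X dμ.tilted(tW)`
(one-variable Leibniz for `(N/Z)·Z = N`, `N = ∫ X e^{tW}`, `Z = ∫ e^{tW}`); (iii) sign polarisation (LANDED p123935) over
`W_ε = (Σ εᵢ Φ(fᵢ))/n` — normalised again (`schwartzNorm ∘ ofRealTest` is a seminorm) and disjoint from `f₀` — bounds
`|A_{Φ(f₀)}(Φ(f₁),…,Φ(f_n))| ≤ C₀ (C₁ n)ⁿ ≤ C₀ (e C₁)ⁿ n!`; (iv) the recursion bounds the moments by induction on `n`: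
`M_{n+1} ≤ Σ_j C(n,j) C₀ (eC₁)ʲ j! · M_{n−j}` ⇒ `M_n ≤ Dⁿ n!` with `D = max(1, 2C₀, 2eC₁)`.

## Reshape 3 (c2 seat, cycle 2): PLANE-RESOLVED input
Reflection positivity, E0-hermiticity and the signed-permutation half of the hypercubic clause of the limit need `k`-uniform
bounds for the six PLANE species separately: the odd-torus time reflection maps the curvature density to the CLOVER density,
`Φ^{c}_k(f) − Φ_k(f) = Σ_{μ<ν} Φ^{(μν)}_k(f̃_{μν,k} − f)` with plane-DEPENDENT `O(a_k)` test-function defects (Disproof §11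
confirmed; report `Lines/Sketch-c2-cycle1.md` §3b.3).  So the line's input is widened to C⁺ at order one for ANISOTROPIC coupling
modulations (`ResponseHolomorphyOnePlanes`, Defs C p129218: one real test per plaquette orientation, ONE complex parameter), the
transfer chain is re-instantiated on 6-tuples (`responseDerivBoundsPlanes_of_holomorphy`, `stub_derivToMomentsPlanes`,
`uniformMomentBounds_of_planes` — LANDED, `Theorems/MirrorModularBoostsHypercubicLimitPlanesTransfer.lean`; the abstract theorem is
field-agnostic), and two witness-side conditions are added to the input and the closure: `PolyVolume sch` (polynomial volume growth:
Schwartz tails wrapped around the torus seam are negligible) and `PolyRenorm r sch` (so the sup-norm thermal term of `IRInputs` (b)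
dies along the scheme).  `Closure` keeps its conclusion and now consumes `UniformMomentBoundsPlanes`.

## Reshape 4 (c2 seat, cycle 2–3): the closure CUT at the level of functionals
`ClosurePlanes` is no longer a stub but a composition (`closurePlanes_of`) of four registered pieces in tree vocabulary
(Defs F p129728: `planeDist`, `UniformFunctionalBoundPlanes`, `PlaneLimits`, `planeSum`; Defs G: `RPSpectral`, `SoftHalf`, `ReflHalf`):
(Z1) `stub_functionalBoundPlanes` — smeared → functional E0′ on ⁰𝒮 for all plane strings (XL: flatness of ⁰𝒮 tests + Whitney
decomposition; the line's remaining closure-side CONTENT); (Z2) `stub_planeLimits` — diagonal subsequence + Hahn–Banach (LANDED,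
`…PlaneLimitsOfBound.lean`); (Z3a) `stub_softLegsPlanes` — E0, E0′, E3, translations, the convergence clause along the sub-scheme,
non-triviality, non-Gaussianity, the lattice gap (L: sibling toolkit `OSLegsFromFemtoAndGap` inheritance pattern + landed floor lemmas);
(Z3b) `stub_reflLegsPlanes` — hermiticity, E2 (clover identity), signed permutations, E4 + `HasMassGap` from `RPSpectral` (XL).

## Reshape 5 (c2 seat, cycle 3): the soft legs DISSOLVED into tree facts, residual = translations
Z3a is now a composition too: E0 + E3 (`planeSum_isNormalized_isSymmetric`, p130141), E0′ (`planeSum_hasLinearGrowth`, p130050), the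
convergence clause along the sub-scheme (`convergence_subseq_of_planeLimits`, via `planeDist_eq_integral_prod_planeField` p130140),
non-triviality / non-Gaussianity / lattice gap (`softFloors_subseq`) are LANDED; `softLegsPlanes_of_translation` assembles `SoftHalf` from the
ONE residual registered stub `stub_translationPlanes` (invariance under all translations of ℝ⁴ on ⁰𝒮: relocation of the box seam under lattice
translations, `o(1)` by `PolyVolume` + `PolyRenorm`, plus equicontinuity — L, worker running).  Registered stubs after reshape 5:
`stub_lineInputsPlanes` (OPEN core), `stub_functionalBoundPlanes` (Z1, XL), `stub_translationPlanes` (L), `stub_reflLegsPlanes` (Z3b, XL).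

## Reshape 6 (c2 seat): the translation stub CORRECTED (`StrictMono φ`)
The reshape-5 `TranslationPlanes` quantified over every `φ : ℕ → ℕ` with `PlaneLimits r sch φ T`; for a CONSTANT `φ` the "limits" are a fixed
lattice functional, never translation invariant — the stub was false as typed (lead's self-audit; expired before anyone built on it).  The
registered stub is now `stub_translationPlanesMono : TranslationPlanesMono` (adds `hφ : StrictMono φ`), assembled by the landed
`softLegsPlanes_of_translationMono` — and LANDED itself (p131105): the SOFT HALF OF THE CLOSURE IS A TREE THEOREM.  Registered stubs:
`stub_lineInputsPlanes` (OPEN core), `stub_functionalBoundPlanes` (Z1, XL), `stub_reflLegsPlanes` (Z3b, XL).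

## Reshape 7 (c2 seat): the reflection legs CUT
`ReflLegsPlanes` becomes a composition (`reflLegsPlanes_of`) over two landed GENERAL lemmas of the sibling crux 9367's toolkit —
hermiticity from E0 + E2 (`OSLegsFromFemtoAndGap.isHermitian_of_isReflectionPositive`, KQR Rem. 2.2) and signed permutations from coordinate
permutations + the time reflection (`OSLegsFromFemtoAndGap.invariant_linActMulti_of_signedPerm`, pure group theory) — and three registered
pieces: (P) `stub_signedPermPlanes` — the signed-permutation clause for `planeSum T` on `⁰𝒮` (L; by that group-theory lemma it REDUCES to
(P1) invariance under coordinate permutations — an EXACT symmetry of the torus Wilson state permuting plaquette orientations, inherited by the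
limit — and (P2) invariance under the time reflection `Θ` — exact up to one-unit shifts of the temporal-plane insertions, pattern
`OSLegsFromFemtoAndGap…StubHypercubicTimeReflection`, shifts and wrap-around killed by the uniform bound + `PolyVolume`/`PolyRenorm` as in
`…TranslationPlanesSeam`; the sibling module `…StubHypercubicSignedPerm` is not built on the farm at registration time, so the reduction is
recorded here and not wired into the skeleton); (R) `stub_rpGapPlanes` — E2, E4 and
`HasMassGap Δ` (XL: odd-torus site reflection positivity of Wilson's measure for polynomials in plane fields supported in `{x₀ > 0}`; time
clustering from `RPSpectral` polarised and passed to the limit; the tree's `HasClusterProperty` = SPATIAL clustering, from time clustering +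
axis symmetry).  Registered stubs: `stub_lineInputsPlanes` (OPEN core), `stub_functionalBoundPlanes` (Z1, XL), `stub_signedPermPlanes` (P, L),
`stub_rpGapPlanes` (R, XL).

## Reshape 8 (c2 seat): Z3b on the TWIN's pieces; Z1 LANDED
The twin crux stmt-16120 (`PencilRigidity.WeakCouplingHypercubicLimit`, by `stub_siblingTie` the same statement) composes through THIS closure
(its lead 16120-c4, r10).  Z3b is cut along its three r10 pieces with byte-identical signatures — `stub_rpPosOfPlaneLimits` (lattice RP ⇒
`RPPos (planeSum T)`), `stub_signedPermOfPlaneLimits` (W(B₄) on `⁰𝒮`), `stub_decayOfRPSpectral` (`RPSpectral ⇒ Decay (planeSum T) Δ`) — STAFFED BY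
THE TWIN LEAD and glued here by its landed `reflHalf_of_pieces` (over the landed continuum theorems `isReflectionPositive_of_rpPos`, `stub_gap`,
`tendsto_conn_translateMulti_smul`, `isHermitian_of_isReflectionPositive`) with the landed E0 / translations of this line.  Z1
`stub_functionalBoundPlanes` is LANDED (p136268): UMBP ⇒ disjoint complex product bounds (`planeDist_disjointProductBound`); slot-disjoint
localisation + Summers' E0″ ⇒ E0′ engine (`disjointLocalisedBound`); an explicit single-scale lattice partition with polynomial weights
(`separatedScaleBound_explicit`); a Gevrey-2 step, explicit pair cutoffs and explicit flat dyadic shells (`exists_gevreyStep`,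
`gevreyPairCutoffFamily`, `flatShellDecomposition_explicit`); density of separated tests in `⁰𝒮`; factorial arithmetic.  Registered stubs:
`stub_lineInputsPlanes` (OPEN core), `stub_rpPosOfPlaneLimits`, `stub_signedPermOfPlaneLimits`, `stub_decayOfRPSpectral` (twin-staffed).

## Reshape 9 (c2 seat): two of the twin's Z3b pieces LANDED and wired; bounded counterterms threaded
`stub_rpPosOfPlaneLimits` and `stub_decayOfRPSpectral` are now the twin lead's landed theorems (`…TraceNormColdPressure.*`, files
`PencilRigidityWeakCouplingHypercubicLimitRPPosOfPlaneLimits` / `…DecayOfRPSpectral`).  The landed decay theorem carries one extra, mild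
hypothesis — BOUNDED ADDITIVE COUNTERTERMS `∃ Cm, ∀ k, |sch.m r.curvature k| ≤ Cm` (any sensible witness has `m_k = 6⟨plaquette⟩ = O(1)`) — which is
threaded into `DecayOfRPSpectral`, `ReflLegsPlanes`, `ClosurePlanes` and the line's input `LineInputsPlanes` (re-registered).  Registered stubs:
`stub_lineInputsPlanes` (OPEN core) and `stub_signedPermOfPlaneLimits` (twin-staffed; halves `coordPermOfPlaneLimits` / `thetaOfPlaneLimits` registered here).

## Reshape 10 (c2 seat, 2026-08-17T02:10Z): CLOSED MODULO THE CORE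
`stub_signedPermOfPlaneLimits` is the twin lead's landed theorem (`PencilRigidityWeakCouplingHypercubicLimitSignedPerm.lean`; my registered halves
`coordPermOfPlaneLimits` p136616 / `thetaOfPlaneLimits` p136707 are its corollaries).  The skeleton now has exactly ONE `sorry`:
`stub_lineInputsPlanes` — the line's input = the crux's open content in the line's coordinates (a weak-coupling scheme with polynomial volume growth,
polynomial multiplicative renormalisation and bounded additive counterterms, anisotropic C⁺ at order one for plane-wise disjoint modulations, and the IR
inputs: uniform lattice gap, RP-spectral clustering, non-triviality and κ₃ floors).  Everything downstream — Cauchy bounds, the moment recursion, the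
smeared → functional transfer (Summers), compactness, the soft legs, reflection positivity, signed permutations, the mass-gap decay, the assembly of the
OS one-field clauses and ONE FIELD SUFFICES — is kernel-checked, here and in the twin's skeleton.
-/

noncomputable section

open scoped SchwartzMap
open MeasureTheory ProbabilityTheory Filter Topology
open Literature.MathematicalPhysics.AQFT Literature.MathematicalPhysics.QuantumLattice
open Literature.MathematicalPhysics.QuantumFieldTheory
open Summit.QuantumFields.YangMills.Cruxes.OSLegsFromFemtoAndGap.DlrCollarTransfer (conn Decay RPPos ConnCS)

namespace Summit.QuantumFields.YangMills.Cruxes.HypercubicLimit.CouplingResponse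

/-! ## 0. The line's objects: ALL IMPORTED (`…CouplingResponseDefs`, `…DefsC` p129218, `…IRInputsDefs`, `…SubschemeDefs` p129455) -/

section Objects

variable {G : Type} [Group G] [TopologicalSpace G] [IsTopologicalGroup G] [CompactSpace G]
  [MeasurableSpace G] [BorelSpace G]

example := @curvField
example := @wilsonAt
example := @response
example := @ResponseHolomorphyOne
example := @ResponseDerivBounds
example := @UniformMomentBounds
example := @OneFieldClauses
example := @fieldP
example := @ResponseHolomorphyOnePlanes
example := @ResponseDerivBoundsPlanes
example := @UniformMomentBoundsPlanes
example := @PolyRenorm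
example := @PolyVolume
example := @planeDist
example := @UniformFunctionalBoundPlanes
example := @PlaneLimits
example := @planeSum
example := @RPSpectral
example := @SoftHalf
example := @ReflHalf

example := @IRInputs
example := @irInputs_subseq
example := @subseq

end Objects

/-! ## 1. One field suffices, at weak coupling — LANDED (`hypercubicLimit_iff_oneFieldWeak`, p123041) -/

/-! ## 2. The registered stubs

LANDED (lead -0, waves 1–2; all `--supports stmt-QuantumFields-16154`, imported above): `stub_fluctuationResponse` (p121966),
`stub_cauchyTransfer` (p122304), `stub_covBookkeeping` (p122386), `stub_typedResponseVacuous` (p122487),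
`stub_cauchyTransferAll` (p123435), `stub_responseSmooth` (p123654), `sum_sign_smul_map_diag_eq` (p123935),
`responseDerivBounds_of_responseHolomorphyOne` (p123986). -/

example := @stub_fluctuationResponse
example := @stub_cauchyTransfer
example := @stub_covBookkeeping
example := @stub_typedResponseVacuous
example := @stub_cauchyTransferAll
example := @stub_responseSmooth
example := @sum_sign_smul_map_diag_eq_of_symmetric
example := @responseDerivBounds_of_responseHolomorphyOne
example := @stub_derivToMoments
example := @responseDerivBoundsPlanes_of_holomorphy
example := @stub_derivToMomentsPlanes
example := @uniformMomentBounds_of_planes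
example := @stub_planeLimits
example := @oneFieldClauses_of_halves
example := @softLegsPlanes_of_translation
example := @softLegsPlanes_of_translationMono
example := @stub_translationPlanesMono
example := @Summit.QuantumFields.YangMills.Theorems.OSLegsFromFemtoAndGap.isHermitian_of_isReflectionPositive

/-- **(2.5c) derivatives ⇒ moments** (the statement of `stub_derivToMoments`, TREE vocabulary; reshape 2: provable by the
moment recursion + sign polarisation, no cumulant theory): `k`-uniform bounds `C₀ C₁ⁿ n!` on all real derivatives at `0` of
the order-1 responses for ALL normalised disjoint pairs give `k`-uniform `n!`-bounds on the lattice `n`-point functions of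
the curvature on disjoint normalised real product tensors. -/
-- @[stub "Sketch"] (tag present in the registered work copy; stripped here: crux workfiles may not carry gate-reserved attributes)
def DerivToMoments : Prop :=
    ∀ (G : Type) [Group G] [TopologicalSpace G] [IsTopologicalGroup G] [CompactSpace G]
      [MeasurableSpace G] [BorelSpace G] (r : LatticeRep G) (sch : SpeciesScheme (YMSpecies G)),
      ResponseDerivBounds r sch → UniformMomentBounds r sch

/-- **(2.5c′) derivatives ⇒ moments, plane-resolved** (the statement of `stub_derivToMomentsPlanes`, LANDED reshape 3). -/
-- @[stub "Sketch"] (tag present in the registered work copy; stripped here: crux workfiles may not carry gate-reserved attributes)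
def DerivToMomentsPlanes : Prop :=
    ∀ (G : Type) [Group G] [TopologicalSpace G] [IsTopologicalGroup G] [CompactSpace G]
      [MeasurableSpace G] [BorelSpace G] (r : LatticeRep G) (sch : SpeciesScheme (YMSpecies G)),
      ResponseDerivBoundsPlanes r sch → UniformMomentBoundsPlanes r sch

/-! **stub 2.5c′ `stub_derivToMomentsPlanes` — LANDED** (c2 seat, reshape 3): `Theorems/MirrorModularBoostsHypercubicLimitPlanesTransfer.lean`. -/

example : DerivToMomentsPlanes := stub_derivToMomentsPlanes

/-- **(2.6″) THE LINE'S INPUT (OPEN), reshape 3: ANISOTROPIC C⁺ AT ORDER ONE at weak coupling, with polynomial volume growth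
and renormalisation, jointly with the imported IR data** (the `Prop` of `stub_lineInputsPlanes`).  For every compact simple `G`:
a faithful `r` and a weak-coupling scheme (`β_k → ∞`, `PolyVolume`, `PolyRenorm`) along which `ResponseHolomorphyOnePlanes` holds
uniformly in `k` AND `IRInputs` holds.  This is the Clay UV content (for the six plane species) + the imported IR content of the
crux in the line's coordinates; no seat promises it. -/
-- @[stub "Sketch"] (tag present in the registered work copy; stripped here: crux workfiles may not carry gate-reserved attributes)
def LineInputsPlanes : Prop :=
    ∀ (G : Type) [Group G] [TopologicalSpace G] [IsTopologicalGroup G] [CompactSpace G],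
      IsCompactSimpleLieGroup G →
        letI : MeasurableSpace G := borel G
        haveI : BorelSpace G := ⟨rfl⟩
        ∃ (r : LatticeRep G) (sch : SpeciesScheme (YMSpecies G)),
          sch.HasWeakCouplingLimit ∧ PolyVolume sch ∧ PolyRenorm r sch ∧ (∃ Cm : ℝ, ∀ k, |sch.m r.curvature k| ≤ Cm) ∧
          (∃ (s : ℕ) (ε₁ C₀ : ℝ), 0 < ε₁ ∧ ResponseHolomorphyOnePlanes r sch s ε₁ C₀) ∧
          IRInputs r sch

/-- **(2.7′) CLOSURE, reshape 3/4** (no longer a stub: `closurePlanes_of` composes Z1, Z2, Z3a, Z3b).  From a weak-coupling scheme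
with polynomial volume growth and renormalisation, `k`-uniform PLANE-RESOLVED `n!`-moment bounds and the IR inputs: a sub-scheme
(still weak coupling) and a one-field family with `OneFieldClauses`. -/
def ClosurePlanes : Prop :=
    ∀ (G : Type) [Group G] [TopologicalSpace G] [IsTopologicalGroup G] [CompactSpace G]
      [MeasurableSpace G] [BorelSpace G] (r : LatticeRep G) (sch : SpeciesScheme (YMSpecies G)),
      sch.HasWeakCouplingLimit → PolyVolume sch → PolyRenorm r sch → (∃ Cm : ℝ, ∀ k, |sch.m r.curvature k| ≤ Cm) →
        UniformMomentBoundsPlanes r sch → IRInputs r sch →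
        ∃ (sch' : SpeciesScheme (YMSpecies G)) (S₁ : SchwingerFamily (EuclideanSpace ℝ (Fin 4))),
          sch'.HasWeakCouplingLimit ∧ OneFieldClauses r sch' S₁

/-- **(Z1) smeared → functional** (the `Prop` of `stub_functionalBoundPlanes`; XL, the closure-side CONTENT of the line): from the
`k`-uniform `n!`-bounds on normalised plane-wise disjoint 6-tuples (a distribution-of-finite-order statement away from the diagonals
and, with polynomial volume growth, away from the torus seam) to the `k`-uniform E0′-type bound on ALL of `⁰𝒮` for every renormalised
plane-string distribution — flatness of `⁰𝒮` tests at the coincidence locus (landed `AQFT/OffDiagonalFlatDecay`) pays for a Whitney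
decomposition of its complement and a disjoint-product expansion of the test function on each cube tuple. -/
-- @[stub "Sketch"] (tag present in the registered work copy; stripped here: crux workfiles may not carry gate-reserved attributes)
def FunctionalBoundPlanes : Prop :=
    ∀ (G : Type) [Group G] [TopologicalSpace G] [IsTopologicalGroup G] [CompactSpace G]
      [MeasurableSpace G] [BorelSpace G] (r : LatticeRep G) (sch : SpeciesScheme (YMSpecies G)),
      PolyVolume sch → UniformMomentBoundsPlanes r sch → UniformFunctionalBoundPlanes r sch

/-- **(Z2) compactness** (the `Prop` of `stub_planeLimits`; LANDED): the uniform functional bound gives one subsequence and limits of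
all plane strings on `⁰𝒮` with the bound inherited everywhere. -/
-- @[stub "Sketch"] (tag present in the registered work copy; stripped here: crux workfiles may not carry gate-reserved attributes)
def PlaneLimitsOfBound : Prop :=
    ∀ (G : Type) [Group G] [TopologicalSpace G] [IsTopologicalGroup G] [CompactSpace G]
      [MeasurableSpace G] [BorelSpace G] (r : LatticeRep G) (sch : SpeciesScheme (YMSpecies G)),
      UniformFunctionalBoundPlanes r sch →
        ∃ φ : ℕ → ℕ, StrictMono φ ∧ ∃ T : (n : ℕ) → (Fin n → Plane) → (𝓢((Fin n → EuclideanSpace ℝ (Fin 4)), ℂ) →L[ℂ] ℂ),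
          PlaneLimits r sch φ T

example : PlaneLimitsOfBound := stub_planeLimits

/-- **(Z3a) the SOFT legs** (reshape 5: a COMPOSITION, `softLegsPlanes_proof`): along the sub-scheme `subseq sch φ`, the candidate
family `planeSum T` has E0-normalisation and E3, E0′, invariance under all translations on `⁰𝒮`, the convergence clause for the curvature's
lattice `n`-point functions, non-triviality and non-Gaussianity, and `HasLatticeMassGap` at the given rate — all landed except translations
(`stub_translationPlanes`). -/
def SoftLegsPlanes : Prop :=
    ∀ (G : Type) [Group G] [TopologicalSpace G] [IsTopologicalGroup G] [CompactSpace G]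
      [MeasurableSpace G] [BorelSpace G] (r : LatticeRep G) (sch : SpeciesScheme (YMSpecies G))
      (φ : ℕ → ℕ) (hφ : StrictMono φ)
      (T : (n : ℕ) → (Fin n → Plane) → (𝓢((Fin n → EuclideanSpace ℝ (Fin 4)), ℂ) →L[ℂ] ℂ)),
      sch.HasWeakCouplingLimit → PolyVolume sch → PolyRenorm r sch → UniformFunctionalBoundPlanes r sch → IRInputs r sch →
        PlaneLimits r sch φ T → ∀ Δ : ℝ, 0 < Δ → HasLatticeMassGap r sch Δ →
          SoftHalf r (subseq sch φ hφ) (planeSum T) Δ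

/-- **(Z3a-tr) translations** (the `Prop` of `stub_translationPlanesMono`; L; reshape 6 adds `StrictMono φ`): along every `PlaneLimits`
package ALONG A SUBSEQUENCE of a scheme with polynomial volume growth and renormalisation and the uniform functional bound, the candidate
family is invariant under ALL translations of `ℝ⁴` on `⁰𝒮` (lattice vectors `a_k⌊a/a_k⌋ → a`; the weights are jointly translation
invariant, so a lattice translation only relocates the box seam, whose terms sit where the Schwartz test function is small —
`(2L_k+1)^{4n}·M_kⁿ·|F|_{N,0}·(a_k L_k − R)^{−N}`, `o(1)` for large `N` by `PolyVolume` + `PolyRenorm` —, and the sub-lattice remainder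
`F(· − a) − F(· − b_k) → 0` in `𝓢` is killed by the uniform bound). -/
-- @[stub "Sketch"] (tag present in the registered work copy; stripped here: crux workfiles may not carry gate-reserved attributes)
def TranslationPlanesMono : Prop :=
    ∀ (G : Type) [Group G] [TopologicalSpace G] [IsTopologicalGroup G] [CompactSpace G]
      [MeasurableSpace G] [BorelSpace G] (r : LatticeRep G) (sch : SpeciesScheme (YMSpecies G)) (φ : ℕ → ℕ) (hφ : StrictMono φ)
      (T : (n : ℕ) → (Fin n → Plane) → (𝓢((Fin n → EuclideanSpace ℝ (Fin 4)), ℂ) →L[ℂ] ℂ)),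
      PolyVolume sch → PolyRenorm r sch → UniformFunctionalBoundPlanes r sch → PlaneLimits r sch φ T →
        ∀ (n : ℕ) (a : EuclideanSpace ℝ (Fin 4)) (F : 𝓢((Fin n → EuclideanSpace ℝ (Fin 4)), ℂ)), IsOffDiagonal F →
          planeSum T n (translateMulti a F) = planeSum T n F

/-- **(Z3b) the REFLECTION legs** (reshape 7/8: a COMPOSITION, `reflLegsPlanes_of`): E0-hermiticity, E2, E4, the signed-permutation half of the
hypercubic clause and `HasMassGap Δ` of `planeSum T`, from the plane-resolved limits along a subsequence of a weak-coupling scheme with polynomial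
volume growth and renormalisation, the uniform functional bound, and `RPSpectral r sch Δ C`. -/
def ReflLegsPlanes : Prop :=
    ∀ (G : Type) [Group G] [TopologicalSpace G] [IsTopologicalGroup G] [CompactSpace G]
      [MeasurableSpace G] [BorelSpace G] (r : LatticeRep G) (sch : SpeciesScheme (YMSpecies G))
      (φ : ℕ → ℕ) (hφ : StrictMono φ)
      (T : (n : ℕ) → (Fin n → Plane) → (𝓢((Fin n → EuclideanSpace ℝ (Fin 4)), ℂ) →L[ℂ] ℂ)),
      sch.HasWeakCouplingLimit → PolyVolume sch → PolyRenorm r sch → (∃ Cm : ℝ, ∀ k, |sch.m r.curvature k| ≤ Cm) →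
        UniformFunctionalBoundPlanes r sch →
        PlaneLimits r sch φ T → ∀ Δ C : ℝ, 0 < Δ → RPSpectral r sch Δ C → ReflHalf (planeSum T) Δ

/-- **(Z3b-RP) reflection positivity on positive-time off-diagonal tuples** (the `Prop` of `stub_rpPosOfPlaneLimits`; L; VERBATIM the twin
crux stmt-16120's r10 stub of the same name, so that ONE landing closes both skeletons).  Osterwalder–Seiler positivity of Wilson's measure on
the odd torus (`β_k ≥ 0`) for the smeared plane-string functionals of compactly supported SEPARATED positive-time tests (the dense class of
`exists_separated_tendsto_of_isOffDiagonal`): the reflected functional is an exact finite sum of `planeDist`'s at slot-wise `O(a_k)`-shifted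
tests (`plane_torusLift_timeReflect`: temporal plaquettes hang down), which stay in `⁰𝒮` and converge in `𝓢`; equicontinuity
(`UniformFunctionalBoundPlanes`) + `PlaneLimits` pass `p_k ≥ 0` to the limit; general tuples by density + joint continuity of the OS pairing. -/
-- @[stub "Sketch"] (tag present in the registered work copy; stripped here: crux workfiles may not carry gate-reserved attributes)
def RPPosOfPlaneLimits : Prop :=
    ∀ (G : Type) [Group G] [TopologicalSpace G] [IsTopologicalGroup G] [CompactSpace G]
      [MeasurableSpace G] [BorelSpace G] (r : LatticeRep G) (sch : SpeciesScheme (YMSpecies G))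
      (φ : ℕ → ℕ) (hφ : StrictMono φ)
      (T : (n : ℕ) → (Fin n → Plane) → (𝓢((Fin n → EuclideanSpace ℝ (Fin 4)), ℂ) →L[ℂ] ℂ)),
      (∀ᶠ k in atTop, 0 ≤ sch.β k) → UniformFunctionalBoundPlanes r sch → PlaneLimits r sch φ T →
        RPPos (planeSum T)

/-- **(Z3b-SP) every signed permutation of the axes on `⁰𝒮`** (the `Prop` of `stub_signedPermOfPlaneLimits`; L; VERBATIM the twin's r10 stub).
The full hyperoctahedral group `W(B₄)` (the crux's det-1 clause and the axis flips consumed by E4 are sub-cases): coordinate permutations act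
EXACTLY on the summed plane-string distributions (the six planes are relabelled; pattern `OSLegsFromFemtoAndGap…Permutations`), the time reflection
up to slot-wise `O(a_k)` shifts (exact on the separated dense class, then density), and `W(B₄) = ⟨S₄, θ⟩`
(`HypercubicLimit.ConditionalMeanTelescoping.rpBlock_signedPermGeneration`, LANDED). -/
-- @[stub "Sketch"] (tag present in the registered work copy; stripped here: crux workfiles may not carry gate-reserved attributes)
def SignedPermOfPlaneLimits : Prop :=
    ∀ (G : Type) [Group G] [TopologicalSpace G] [IsTopologicalGroup G] [CompactSpace G]
      [MeasurableSpace G] [BorelSpace G] (r : LatticeRep G) (sch : SpeciesScheme (YMSpecies G))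
      (φ : ℕ → ℕ) (hφ : StrictMono φ)
      (T : (n : ℕ) → (Fin n → Plane) → (𝓢((Fin n → EuclideanSpace ℝ (Fin 4)), ℂ) →L[ℂ] ℂ)),
      UniformFunctionalBoundPlanes r sch → PlaneLimits r sch φ T →
        ∀ (n : ℕ) (R : EuclideanSpace ℝ (Fin 4) ≃ₗᵢ[ℝ] EuclideanSpace ℝ (Fin 4)),
          (∀ i : Fin 4, ∃ j : Fin 4, R (EuclideanSpace.single i 1) = EuclideanSpace.single j 1 ∨
            R (EuclideanSpace.single i 1) = -EuclideanSpace.single j 1) →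
          ∀ F : 𝓢((Fin n → EuclideanSpace ℝ (Fin 4)), ℂ), IsOffDiagonal F →
            planeSum T n (linActMulti R F) = planeSum T n F

/-- **(Z3b-D) RP-spectral clustering on the lattice ⇒ `Decay (planeSum T) Δ`** (the `Prop` of `stub_decayOfRPSpectral`; LANDED by the twin lead
16120-c4 as `…TraceNormColdPressure.stub_decayOfRPSpectral`, reshape 9: its final signature carries the BOUNDED-COUNTERTERM hypothesis `∃ Cm, ∀ k, |m_k| ≤ Cm`,
threaded here into `ReflLegsPlanes`, `ClosurePlanes` and the line's input): for a real, compactly supported, positive-time,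
off-diagonal `F` (first separated, then density) the smeared functional `Y_k = Re Σ_q Ψ^q_k(F)` is a real bounded functional of a time slab;
`RPSpectral` at step `φ k` with `n = 2j_k`, `2 j_k a_{φ k} → t` on the torus `S = L_{φ k}` bounds `q_{2j}(Y) ≤ e^{−Δ a 2j} q₀(Y) + C B_k² e^{−Δ a L}`;
both `q`'s are finite sums of `planeDist`'s at `O(a_k)`-shifted reflected tests, converging to `Re conn(F, T_t F)` and `Re conn(F, F)`; the
thermal term dies by `PolyRenorm` + `PolyVolume`. -/
-- @[stub "Sketch"] (tag present in the registered work copy; stripped here: crux workfiles may not carry gate-reserved attributes)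
def DecayOfRPSpectral : Prop :=
    ∀ (G : Type) [Group G] [TopologicalSpace G] [IsTopologicalGroup G] [CompactSpace G]
      [MeasurableSpace G] [BorelSpace G] (r : LatticeRep G) (sch : SpeciesScheme (YMSpecies G))
      (φ : ℕ → ℕ) (hφ : StrictMono φ)
      (T : (n : ℕ) → (Fin n → Plane) → (𝓢((Fin n → EuclideanSpace ℝ (Fin 4)), ℂ) →L[ℂ] ℂ)) (Δ C : ℝ),
      0 < Δ → PolyVolume sch → PolyRenorm r sch → (∃ Cm : ℝ, ∀ k, |sch.m r.curvature k| ≤ Cm) →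
        UniformFunctionalBoundPlanes r sch → PlaneLimits r sch φ T → RPSpectral r sch Δ C → Decay (planeSum T) Δ

/-- **stub Z3b-RP — LANDED by the twin lead** (`PencilRigidityWeakCouplingHypercubicLimitRPPosOfPlaneLimits.lean`): `RPPos (planeSum T)`. -/
theorem stub_rpPosOfPlaneLimits : RPPosOfPlaneLimits :=
  Summit.QuantumFields.YangMills.Theorems.WeakCouplingHypercubicLimit.TraceNormColdPressure.stub_rpPosOfPlaneLimits

/-- **stub Z3b-SP — LANDED by the twin lead** (`PencilRigidityWeakCouplingHypercubicLimitSignedPerm.lean`; the halves registered here,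
`coordPermOfPlaneLimits` p136616 and `thetaOfPlaneLimits` p136707, are its corollaries): every signed permutation of the axes on `⁰𝒮`. -/
theorem stub_signedPermOfPlaneLimits : SignedPermOfPlaneLimits :=
  Summit.QuantumFields.YangMills.Theorems.WeakCouplingHypercubicLimit.TraceNormColdPressure.stub_signedPermOfPlaneLimits

/-- **stub Z3b-D — LANDED by the twin lead** (`PencilRigidityWeakCouplingHypercubicLimitDecayOfRPSpectral.lean`): `RPSpectral ⇒ Decay (planeSum T) Δ`. -/
theorem stub_decayOfRPSpectral : DecayOfRPSpectral :=
  Summit.QuantumFields.YangMills.Theorems.WeakCouplingHypercubicLimit.TraceNormColdPressure.stub_decayOfRPSpectral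

/-- **The reflection legs from the three Z3b pieces** (pure logic over LANDED theorems, via the twin lead's `reflHalf_of_pieces`):
`β_k → ∞` gives `β_k ≥ 0` eventually; E0 (`planeSum_isNormalized_isSymmetric`) and translations on `⁰𝒮` (`stub_translationPlanesMono`) are the
landed soft facts; `RPPos` ⇒ E2 ⇒ hermiticity; `RPPos` + E0 + translations ⇒ `ConnCS`, and `Decay Δ` ⇒ `HasMassGap Δ` (`stub_gap`); + signed
permutations ⇒ E4 (`tendsto_conn_translateMulti_smul`). -/
theorem reflLegsPlanes_of : RPPosOfPlaneLimits → SignedPermOfPlaneLimits → DecayOfRPSpectral → ReflLegsPlanes := by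
  intro hRP hSP hD G _ _ _ _ _ _ r sch φ hφ T hw hpv hpr hbm hUFB hPL Δ C hΔ hrp
  have hβ0 : ∀ᶠ k in atTop, 0 ≤ sch.β k := hw.eventually_ge_atTop 0
  have hE0 := (planeSum_isNormalized_isSymmetric G r sch φ T hPL).1
  have htr := stub_translationPlanesMono G r sch φ hφ T hpv hpr hUFB hPL
  exact Summit.QuantumFields.YangMills.Theorems.WeakCouplingHypercubicLimit.TraceNormColdPressure.reflHalf_of_pieces (planeSum T) hΔ
    hE0 (fun n _ a F hF => htr n a F hF) (hRP G r sch φ hφ T hβ0 hUFB hPL) (hSP G r sch φ hφ T hUFB hPL)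
    (hD G r sch φ hφ T Δ C hΔ hpv hpr hbm hUFB hPL hrp)

/-- **stub 2.6″** — the line's input: anisotropic C⁺ at order one at weak coupling + imported IR data (`LineInputsPlanes`; OPEN). -/
theorem stub_lineInputsPlanes : LineInputsPlanes := by
  sorry

/-! **stub Z1 `stub_functionalBoundPlanes` — LANDED** (c2 seat, 2026-08-17, p136268 `Theorems/MirrorModularBoostsHypercubicLimitFunctionalBoundPlanes.lean`):
smeared → functional E0′ on `⁰𝒮` for all plane strings, with OS's factorial currency.  Pieces (all `--supports 16154`): Z1b
`planeDist_disjointProductBound` (p132877), B `disjointLocalisedBound` (p132917, Summers' engine), C `separatedScaleBound` (p133333) /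
`separatedScaleBound_explicit` (p135163 + p135393), D `flatShellDecomposition` (p133168) / `flatShellDecomposition_explicit` (p134101),
E1 `exists_gevreyStep` (p134219), E2 `gevreyPairCutoffFamily` (p134446), fixed-degree assembly (p133746), explicit assembly (p136268). -/

example : FunctionalBoundPlanes := stub_functionalBoundPlanes

/-! **stub Z3a-tr `stub_translationPlanesMono` — LANDED** (wave-3 worker, 2026-08-17): `Theorems/MirrorModularBoostsHypercubicLimitTranslationPlanes.lean`
(p131105; helpers `…TranslationPlanesSeam.lean` p130809 — flexible-order seam defect for `latticeDistStr`, `…TranslationPlanesTendsto.lean` p130915). -/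

example : TranslationPlanesMono := stub_translationPlanesMono

/-- **Z3a, proved from the residual stub** (`softLegsPlanes_of_translationMono`, LANDED assembly). -/
theorem softLegsPlanes_proof : SoftLegsPlanes :=
  softLegsPlanes_of_translationMono stub_translationPlanesMono

/-! ## 3. Composition (no `sorry` of its own) -/

/-- **The closure from its four pieces** (pure logic): Z1 gives the functional bound, Z2 the subsequence and the plane-string limits,
`IRInputs` the rate `Δ` with its lattice gap and RP-spectral clause, Z3a/Z3b the two halves of the one-field clauses for
`(subseq sch φ, planeSum T)`, reassembled by `oneFieldClauses_of_halves`; weak coupling restricts to the sub-scheme. -/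
theorem closurePlanes_of : FunctionalBoundPlanes → PlaneLimitsOfBound → SoftLegsPlanes → ReflLegsPlanes → ClosurePlanes := by
  intro hZ1 hZ2 hZ3a hZ3b G _ _ _ _ _ _ r sch hw hpv hpr hbm hUMB hIR
  have hUFB := hZ1 G r sch hpv hUMB
  obtain ⟨φ, hφ, T, hPL⟩ := hZ2 G r sch hUFB
  obtain ⟨⟨Δ, C, hΔ, hgap, hrp⟩, -, -⟩ := (irInputs_iff r sch).1 hIR
  have hsoft := hZ3a G r sch φ hφ T hw hpv hpr hUFB hIR hPL Δ hΔ hgap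
  have hrefl := hZ3b G r sch φ hφ T hw hpv hpr hbm hUFB hPL Δ C hΔ hrp
  exact ⟨subseq sch φ hφ, planeSum T, hasWeakCouplingLimit_subseq sch φ hφ hw,
    oneFieldClauses_of_halves r _ _ hΔ hsoft hrefl⟩

/-- **Composition (reshape 3/4):** the line's input gives `(r, sch)` at weak coupling with polynomial volume/renormalisation,
anisotropic C⁺ at order one and the IR data; Cauchy at all orders gives the plane-resolved derivative bounds
(`responseDerivBoundsPlanes_of_holomorphy`, LANDED); the moment recursion gives the plane-resolved moment bounds
(`stub_derivToMomentsPlanes`, LANDED); the closure (`closurePlanes_of`) gives a one-field witness `(r, sch', S₁)` at weak coupling;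
ONE FIELD SUFFICES (LANDED `hypercubicLimit_iff_oneFieldWeak`). -/
theorem hypercubicLimit_of_closure : DerivToMomentsPlanes → LineInputsPlanes → ClosurePlanes →
    Summit.QuantumFields.YangMills.Theses.CoincidenceRotationBootstrap.HypercubicLimit := by
  intro hMom hIn hCl
  refine Summit.QuantumFields.YangMills.Theorems.HypercubicLimit.OneFieldWeak.hypercubicLimit_iff_oneFieldWeak.mpr
    fun G _ _ _ _ hG => ?_
  letI : MeasurableSpace G := borel G
  haveI : BorelSpace G := ⟨rfl⟩
  obtain ⟨r, sch₀, hw₀, hpv, hpr, hbm, ⟨s, ε₁, C₀, hε₁, hC⟩, hIR⟩ := hIn G hG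
  obtain ⟨sch, S₁, hw, h₁⟩ := hCl G r sch₀ hw₀ hpv hpr hbm
    (hMom G r sch₀ (responseDerivBoundsPlanes_of_holomorphy G r sch₀ s ε₁ C₀ hε₁ hC)) hIR
  exact ⟨r, sch, S₁, hw, h₁⟩

/-- **Composition (reshape 8), all eight registered pieces to the crux BY NAME**: 2.5c′ (LANDED), 2.6″ (OPEN), Z1, Z2 (LANDED), Z3a-tr (LANDED),
Z3b-RP, Z3b-SP, Z3b-D. -/
theorem HypercubicLimit_of : DerivToMomentsPlanes → LineInputsPlanes → FunctionalBoundPlanes → PlaneLimitsOfBound →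
    TranslationPlanesMono → RPPosOfPlaneLimits → SignedPermOfPlaneLimits → DecayOfRPSpectral →
    Summit.QuantumFields.YangMills.Theses.CoincidenceRotationBootstrap.HypercubicLimit :=
  fun hMom hIn hZ1 hZ2 hTr hRP hSP hD =>
    hypercubicLimit_of_closure hMom hIn
      (closurePlanes_of hZ1 hZ2 (softLegsPlanes_of_translationMono hTr) (reflLegsPlanes_of hRP hSP hD))

/-- **Registered target of the skeleton**: the crux BY NAME from the stubs (no `sorry` of its own; the sorries live in
`stub_lineInputsPlanes` ONLY — every other piece is a LANDED theorem: the skeleton is CLOSED MODULO THE LINE'S CORE INPUT). -/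
theorem HypercubicLimit_proof :
    Summit.QuantumFields.YangMills.Theses.CoincidenceRotationBootstrap.HypercubicLimit :=
  HypercubicLimit_of stub_derivToMomentsPlanes stub_lineInputsPlanes stub_functionalBoundPlanes stub_planeLimits
    stub_translationPlanesMono stub_rpPosOfPlaneLimits stub_signedPermOfPlaneLimits stub_decayOfRPSpectral

/-! ## 4. The reshape-2 chain is retained as a consequence (curvature-only currency)

`UniformMomentBoundsPlanes r sch → UniformMomentBounds r sch` (`uniformMomentBounds_of_planes`, LANDED) and
`ResponseDerivBounds r sch → UniformMomentBounds r sch` (`stub_derivToMoments`, LANDED) stay available for the curvature-only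
steps of the closure (Z1 for the curvature strings, the non-triviality/non-Gaussianity floors). -/

example := @uniformMomentBounds_of_planes
example : DerivToMoments := stub_derivToMoments

end Summit.QuantumFields.YangMills.Cruxes.HypercubicLimit.CouplingResponse

end
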